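import Literature.Probability.RandomPlanarGeometry.SLETwoPointItoProofs
import Literature.Probability.RandomPlanarGeometry.CardyFunctionIncBeta
import Literature.Probability.RandomPlanarGeometry.ConformalRectangleProofs
import Literature.Probability.RandomPlanarGeometry.LocalMartingaleProofs
import Literature.Probability.RandomPlanarGeometry.ChordalCurveFamily

/-!
# Chordal SLE₆ crossing probabilities of conformal rectangles are non-degenerate

Topic `Probability/RandomPlanarGeometry`; theorems only, unconditional. By-product of line
`isotropy-kills-beltrami` on crux `CardyRotToConfR2SymmetryUpgrade` (stmt-CriticalPhenomena-0698): the
necessity half of its regularity stub — conjunct "(a) crossing probabilities in (0,1)" holds for every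
family of chordal SLE₆ laws.

* `cardyFunction_mem_Ioo` — Cardy's value `F(η)` lies in `(0, 1)` for `η ∈ (0, 1)`
  (`strictMonoOn_cardyFunction_holds`, `cardyFunction_zero`, `cardyFunction_one_holds`);
* `sle_six_measure_hitsBefore_eq` — Cardy's formula for SLE₆ (`sle_six_measureReal_hitsBefore_holds`)
  in `ℝ≥0∞` form: `μ (hitsBefore (x₂x₃) (x₁x₂)) = ENNReal.ofReal (F η)`;
* `sle_six_measure_hitsBefore_mem_Ioo`, `ChordalFamily.crossing_mem_Ioo_of_isSLELaw` — in every conformal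
  rectangle the SLE₆ curve from `x₀` to `x₂` hits `(x₂x₃)` before `(x₁x₂)` with probability strictly
  between `0` and `1` (uniformizing data exist by `MarkedDomain.exists_isUniformizing_holds`, their
  cross-ratio lies in `(0, 1)` by `ConformalRectangle.crossRatio_mem_Ioo_of_isUniformizing`).

References: J. Cardy, J. Phys. A 25 (1992) L201, eq. (8); W. Werner, *Lectures on two-dimensional
critical percolation* (2007), §3; G. F. Lawler, O. Schramm, W. Werner, Acta Math. 187 (2001), §3.
-/

noncomputable section

open Set MeasureTheory Topology Filter
open UpperHalfPlane (upperHalfPlaneSet)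
open scoped unitInterval ENNReal NNReal

namespace Literature.Probability.RandomPlanarGeometry


/-- Cardy's function takes values strictly between `0` and `1` on the open interval `(0, 1)`:
it is strictly increasing on `[0, 1]` (Cardy 1992, eq. (8)) with `F(0) = 0` and `F(1) = 1`
(Gauss's summation theorem). [folklore] -/
theorem cardyFunction_mem_Ioo {η : ℝ} (hη : η ∈ Ioo (0 : ℝ) 1) :
    cardyFunction η ∈ Ioo (0 : ℝ) 1 := by
  have hmono : StrictMonoOn cardyFunction (Icc 0 1) := strictMonoOn_cardyFunction_holds
  have hF1 : cardyFunction 1 = 1 := cardyFunction_one_holds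
  have hη' : η ∈ Icc (0 : ℝ) 1 := ⟨hη.1.le, hη.2.le⟩
  constructor
  · have h := hmono (left_mem_Icc.2 zero_le_one) hη' hη.1
    rwa [cardyFunction_zero] at h
  · have h := hmono hη' (right_mem_Icc.2 zero_le_one) hη.2
    rwa [hF1] at h

/-- **Cardy's formula for SLE₆, `ℝ≥0∞` form.** For the chordal SLE₆ law `μ` of `(Ω; x₀, x₂)` in a
conformal rectangle `R = (Ω; x₀, x₁, x₂, x₃)` and any uniformizing datum `(φ, x)` of `R`, the
probability that the curve hits `(x₂x₃) = R.arc 2` before `(x₁x₂) = R.arc 1` is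
`ENNReal.ofReal (F (crossRatio x))` (`sle_six_measureReal_hitsBefore_holds`; `μ` is a probability
measure by `IsSLELaw.isProbabilityMeasure` and `isProjectiveLimit_preWienerMeasure_holds`).
[cite: Werner2007, §3] -/
theorem sle_six_measure_hitsBefore_eq {R : ConformalRectangle} {μ : Measure (CurveClass ℂ)}
    (hμ : IsSLELaw 6 (R.chord 0 2 (by decide)) μ)
    {φ : ConformalEquiv upperHalfPlaneSet R.carrier} {x : Fin 4 → ℝ} (hφ : R.IsUniformizing φ x) :
    μ (CurveClass.hitsBefore (R.arc 2) (R.arc 1)) = ENNReal.ofReal (cardyFunction (crossRatio x)) := by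
  haveI : Fact Literature.Probability.Process.isProjectiveLimit_preWienerMeasure :=
    ⟨isProjectiveLimit_preWienerMeasure_holds⟩
  haveI := hμ.isProbabilityMeasure
  rw [← sle_six_measureReal_hitsBefore_holds R hμ hφ, measureReal_def,
    ENNReal.ofReal_toReal (measure_ne_top μ _)]

/-- The SLE₆ crossing probability of every conformal rectangle lies strictly between `0` and `1`:
it is Cardy's value `F(η)` of the conformal modulus `η ∈ (0, 1)` (uniformizing data exist by the
Riemann mapping theorem + Carathéodory, `MarkedDomain.exists_isUniformizing_holds`). [cite: Werner2007, §3] -/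
theorem sle_six_measure_hitsBefore_mem_Ioo {R : ConformalRectangle} {μ : Measure (CurveClass ℂ)}
    (hμ : IsSLELaw 6 (R.chord 0 2 (by decide)) μ) :
    0 < μ (CurveClass.hitsBefore (R.arc 2) (R.arc 1)) ∧
      μ (CurveClass.hitsBefore (R.arc 2) (R.arc 1)) < 1 := by
  obtain ⟨φ, x, hφ⟩ := MarkedDomain.exists_isUniformizing_holds R
  have hF := cardyFunction_mem_Ioo (ConformalRectangle.crossRatio_mem_Ioo_of_isUniformizing hφ)
  rw [sle_six_measure_hitsBefore_eq hμ hφ]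
  exact ⟨ENNReal.ofReal_pos.2 hF.1, ENNReal.ofReal_lt_one.2 hF.2⟩

/-- **Conjunct (a) of S0 holds for every family of SLE₆ laws** (necessity / consistency check for
the regularity stub `stub_regularityFromAxioms` of line `isotropy-kills-beltrami`): if `P D` is the
chordal SLE₆ law of `D` for every Dobrushin domain `D`, then in every conformal rectangle the curve
of `R.chord 0 2` hits `R.arc 2` before `R.arc 1` with probability in `(0, 1)`. [cite: Werner2007, §3] -/
theorem ChordalFamily.crossing_mem_Ioo_of_isSLELaw :
    ∀ P : ChordalFamily, (∀ D : DobrushinDomain, IsSLELaw 6 D (P D)) →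
      ∀ R : ConformalRectangle,
        0 < P (R.chord 0 2 (by decide)) (CurveClass.hitsBefore (R.arc 2) (R.arc 1)) ∧
          P (R.chord 0 2 (by decide)) (CurveClass.hitsBefore (R.arc 2) (R.arc 1)) < 1 :=
  fun _ hP _ => sle_six_measure_hitsBefore_mem_Ioo (hP _)

end Literature.Probability.RandomPlanarGeometry
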